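import Summits.Ventures.Crystal3D.Theorems.StickyWulffConstantNoReconstructionGainExactCriminalDensity
import Summits.Ventures.Crystal3D.Theorems.StickyWulffConstantNoReconstructionGainExactCriminalOffLattice
import Summits.Ventures.Crystal3D.Theorems.StickyWulffConstantNoReconstructionGainLowCoordAdhesion
import HarnessLib

/-!
# Criminals carry a HEAVY off-lattice ball and at least nine off-lattice balls
# (line `replication-exactness`, structure of minimal counterexamples to EXACT₀)

HONEST FRAMING. Part of the venture `Summits/Ventures/Crystal3D` (cell `crystal3d-full`), supports the
crux `NoReconstructionGain` (stmt-Ventures-19144, route `route-Ventures-StickyWulffConstant`), line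
`replication-exactness` (lead wulff-p1 g18).  Continuing the anatomy of a CRIMINAL (a nonempty film on a
rigid half-crystal face all of whose nonempty sub-blocks are strictly over-attached; one criminal refutes
the crux for every `R, C` by `not_noReconstructionGain_of_criminal`) with the tree's kissing theorems:

* `plug_add_deg_le_twelve` — a film ball has at most `12` partners in all, substrate plugs included
  (the kissing number `k(3) = 12`, tree theorem `musin2006_kissing_three_holds` via
  `card_partners_le_twelve`);
* `twelve_mul_lt_sum_offDeg_add_two_mul_latt_of_criminal` — the block inequality at the OFF-LATTICE
  block `Q_off` in per-ball form: `12·#Q_off < Σ_{q ∈ Q_off} (deg_off q + 2·latt q)`, where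
  `deg_off q` counts the off-lattice film partners of `q` and `latt q ≤ 3` its lattice contacts
  (plugs + on-lattice film partners, `plug_add_onLattice_le_three`);
* `exists_heavy_offLattice_of_criminal` — hence **every criminal contains a HEAVY off-lattice ball**:
  `deg_off q + 2·latt q ≥ 13`; by the kissing bound such a ball has `latt q ≥ 1`, `deg_off q ≥ 7`,
  and TOTAL coordination `plug q + deg_Q q ≥ 10` (`ten_le_plug_add_deg_of_heavy`).  So criminals live
  exactly where the pointwise weighted-kissing method is known to die (`…WKNoGo`: coordination `≥ 10`):
  an off-lattice ball with at least ten contacts, at least seven of them off-lattice and at least one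
  on the lattice;
* `eight_le_card_offLattice_of_criminal`, `nine_le_card_offLattice_of_criminal` — **a criminal has at
  least NINE off-lattice balls**: `Q_off` has more than `3·#Q_off` internal contacts
  (`contactDeficiency_offLattice_lt_of_criminal`), more than the `#Q_off (#Q_off − 1)/2` pairs allow for
  `#Q_off ≤ 7`; and eight balls with `≥ 25` contacts miss at most three of their `28` pairs, so five of
  them touch pairwise — impossible in `ℝ³` (`no_five_pairwise_dist_two`).

WHAT THIS IS NOT: the crux (`stub_noCriminal` = EXACT₀ is open); `#Q_off ≥ 17` would follow from the
contact-number tables `c(n) ≤ 3n (n ≤ 16)`, which are not in the tree; rung F-C1 not moved.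
-/

noncomputable section

namespace Summit.Ventures.Crystal3D.Theorems

open Summit.Ventures.Crystal3D
open Literature.MathematicalPhysics.StatisticalMechanics (fccStacking isHaggSeq_const
  le_dist_of_mem_barlowStacking_ideal contactDeficiency orderedContacts)
open scoped InnerProductSpace
open Finset

/-! ## Kissing: at most twelve partners, plugs included -/

/-- **A film ball has at most twelve partners, plugs included** (kissing number `k(3) = 12`). -/
theorem plug_add_deg_le_twelve {ν : EuclideanSpace ℝ (Fin 3)} {s : ℝ}
    {Q : Finset (EuclideanSpace ℝ (Fin 3))} (hQ : IsFilmOn ν s Q) (q : EuclideanSpace ℝ (Fin 3)) :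
    (plugSet ν s q).ncard + (Q.filter fun y => dist q y = 1).card ≤ 12 := by
  classical
  have hfin := plugSet_finite ν s q
  -- the plugs together with the film form a unit packing
  set X := hfin.toFinset ∪ Q with hX
  have hpack : ∀ p ∈ X, ∀ p' ∈ X, p ≠ p' → 1 ≤ dist p p' := by
    intro p hp p' hp' hne
    rw [hX, Finset.mem_union, Set.Finite.mem_toFinset] at hp hp'
    rcases hp with hp | hp <;> rcases hp' with hp' | hp'
    · exact le_dist_of_mem_barlowStacking_ideal isHaggSeq_const one_pos fcc_height_sq hp.1.1 hp'.1.1 hne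
    · rw [dist_comm]; exact hQ.2 p' hp' p hp.1
    · exact hQ.2 p hp p' hp'.1
    · exact hQ.1 p hp p' hp' hne
  have h12 := card_partners_le_twelve X hpack q
  -- plugs and film partners are disjoint subsets of the partners of `q` in `X`
  have hdisj : Disjoint hfin.toFinset (Q.filter fun y => dist q y = 1) := by
    rw [Finset.disjoint_left]
    intro y hy hy'
    rw [Set.Finite.mem_toFinset] at hy
    rw [Finset.mem_filter] at hy'
    have := hQ.2 y hy'.1 y hy.1
    rw [dist_self] at this; linarith
  have hsub : hfin.toFinset ∪ (Q.filter fun y => dist q y = 1) ⊆ X.filter fun x => dist q x = 1 := by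
    intro y hy
    rw [Finset.mem_filter, hX, Finset.mem_union]
    rw [Finset.mem_union, Set.Finite.mem_toFinset, Finset.mem_filter] at hy
    rcases hy with hy | hy
    · exact ⟨Or.inl (by rw [Set.Finite.mem_toFinset]; exact hy), hy.2⟩
    · exact ⟨Or.inr hy.1, hy.2⟩
  have hle := Finset.card_le_card hsub
  rw [Finset.card_union_of_disjoint hdisj, ← Set.ncard_eq_toFinset_card _ hfin] at hle
  omega

/-! ## The heavy off-lattice ball -/

open scoped Classical in
/-- **The block inequality at the off-lattice block, per ball**: in a criminal,
`12·#Q_off < Σ_{q ∈ Q_off} (deg_off q + 2·(plug q + on-lattice partners of q))`. -/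
theorem twelve_mul_lt_sum_offDeg_add_two_mul_latt_of_criminal {ν : EuclideanSpace ℝ (Fin 3)} {s : ℝ}
    {Q : Finset (EuclideanSpace ℝ (Fin 3))} (hQ : IsCriminal ν s Q) :
    12 * (Q.filter fun y => y ∉ fccStacking 1 (Real.sqrt (2 / 3))).card <
      ∑ q ∈ Q.filter (fun y => y ∉ fccStacking 1 (Real.sqrt (2 / 3))),
        (((Q.filter fun y => y ∉ fccStacking 1 (Real.sqrt (2 / 3))).filter fun y => dist q y = 1).card +
          2 * ((plugSet ν s q).ncard +
            (Q.filter fun y => y ∈ fccStacking 1 (Real.sqrt (2 / 3)) ∧ dist q y = 1).card)) := by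
  set O := Q.filter fun y => y ∉ fccStacking 1 (Real.sqrt (2 / 3)) with hO
  have hOQ : O ⊆ Q := Finset.filter_subset _ _
  have hOne : O.Nonempty := by
    obtain ⟨q, hq, hqΛ⟩ := exists_not_mem_fcc_of_criminal hQ
    exact ⟨q, Finset.mem_filter.2 ⟨hq, hqΛ⟩⟩
  have hblock := hQ.2.2 O hOQ hOne
  -- rewrite every term of the block inequality as a sum over `O`
  have hD : contactDeficiency O = 6 * (O.card : ℝ) - (orderedContacts O : ℝ) / 2 := rfl
  have hord := orderedContacts_eq_sum_card_partners O
  have hcross : (((Q \ O) ×ˢ O).filter fun pq => dist pq.1 pq.2 = 1).card =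
      ∑ q ∈ O, (Q.filter fun y => y ∈ fccStacking 1 (Real.sqrt (2 / 3)) ∧ dist q y = 1).card := by
    rw [card_cross_eq_sum]
    refine Finset.sum_congr rfl fun q _ => ?_
    congr 1
    ext p
    simp only [Finset.mem_filter, Finset.mem_sdiff, hO, not_and, not_not]
    constructor
    · rintro ⟨⟨hpQ, hpΛ⟩, hd⟩
      exact ⟨hpQ, hpΛ hpQ, by rw [dist_comm]; exact hd⟩
    · rintro ⟨hpQ, hpΛ, hd⟩
      exact ⟨⟨hpQ, fun _ => hpΛ⟩, by rw [dist_comm]; exact hd⟩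
  rw [plugCount, hcross, hD] at hblock
  rw [hord] at hblock
  push_cast at hblock
  -- clear denominators and read off the integer inequality
  have key : (12 : ℝ) * O.card < ∑ q ∈ O, ((((O.filter fun y => dist q y = 1).card : ℕ) : ℝ) +
      2 * ((((plugSet ν s q).ncard : ℕ) : ℝ) +
        (((Q.filter fun y => y ∈ fccStacking 1 (Real.sqrt (2 / 3)) ∧ dist q y = 1).card : ℕ) : ℝ))) := by
    rw [Finset.sum_add_distrib, ← Finset.mul_sum, Finset.sum_add_distrib]
    linarith
  exact_mod_cast key

open scoped Classical in
/-- **Every criminal contains a heavy off-lattice ball**: an off-lattice ball `q` with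
`deg_off q + 2·(plug q + on-lattice partners of q) ≥ 13`. -/
theorem exists_heavy_offLattice_of_criminal {ν : EuclideanSpace ℝ (Fin 3)} {s : ℝ}
    {Q : Finset (EuclideanSpace ℝ (Fin 3))} (hQ : IsCriminal ν s Q) :
    ∃ q ∈ Q, q ∉ fccStacking 1 (Real.sqrt (2 / 3)) ∧
      13 ≤ ((Q.filter fun y => y ∉ fccStacking 1 (Real.sqrt (2 / 3)) ∧ dist q y = 1).card +
        2 * ((plugSet ν s q).ncard +
          (Q.filter fun y => y ∈ fccStacking 1 (Real.sqrt (2 / 3)) ∧ dist q y = 1).card)) := by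
  set O := Q.filter fun y => y ∉ fccStacking 1 (Real.sqrt (2 / 3)) with hO
  have h := twelve_mul_lt_sum_offDeg_add_two_mul_latt_of_criminal hQ
  rw [← hO] at h
  have h' : ∑ _q ∈ O, 12 < ∑ q ∈ O, ((O.filter fun y => dist q y = 1).card +
      2 * ((plugSet ν s q).ncard +
        (Q.filter fun y => y ∈ fccStacking 1 (Real.sqrt (2 / 3)) ∧ dist q y = 1).card)) := by
    rw [Finset.sum_const, smul_eq_mul, mul_comm]; exact h
  obtain ⟨q, hqO, hlt⟩ := Finset.exists_lt_of_sum_lt h'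
  obtain ⟨hqQ, hqΛ⟩ := Finset.mem_filter.1 hqO
  refine ⟨q, hqQ, hqΛ, ?_⟩
  have heq : (O.filter fun y => dist q y = 1) =
      Q.filter fun y => y ∉ fccStacking 1 (Real.sqrt (2 / 3)) ∧ dist q y = 1 := by
    rw [hO, Finset.filter_filter]
  rw [heq] at hlt
  omega

open scoped Classical in
/-- The partners of a film ball split into off-lattice and on-lattice ones. -/
theorem card_partners_eq_off_add_on (Q : Finset (EuclideanSpace ℝ (Fin 3)))
    (q : EuclideanSpace ℝ (Fin 3)) :
    (Q.filter fun y => dist q y = 1).card =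
      (Q.filter fun y => y ∉ fccStacking 1 (Real.sqrt (2 / 3)) ∧ dist q y = 1).card +
        (Q.filter fun y => y ∈ fccStacking 1 (Real.sqrt (2 / 3)) ∧ dist q y = 1).card := by
  rw [← Finset.card_union_of_disjoint]
  · congr 1
    ext y
    simp only [Finset.mem_union, Finset.mem_filter]
    tauto
  · rw [Finset.disjoint_left]
    intro y hy hy'
    exact (Finset.mem_filter.1 hy).2.1 (Finset.mem_filter.1 hy').2.1

open scoped Classical in
/-- **A heavy off-lattice ball has at least ten contacts, at least one of them a lattice contact and
at least seven of them off-lattice** (kissing bound `plug + deg ≤ 12`, `latt ≤ 3`). -/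
theorem ten_le_plug_add_deg_of_heavy {ν : EuclideanSpace ℝ (Fin 3)} {s : ℝ}
    {Q : Finset (EuclideanSpace ℝ (Fin 3))} (hQ : IsFilmOn ν s Q) {q : EuclideanSpace ℝ (Fin 3)}
    (hqΛ : q ∉ fccStacking 1 (Real.sqrt (2 / 3)))
    (h13 : 13 ≤ ((Q.filter fun y => y ∉ fccStacking 1 (Real.sqrt (2 / 3)) ∧ dist q y = 1).card +
        2 * ((plugSet ν s q).ncard +
          (Q.filter fun y => y ∈ fccStacking 1 (Real.sqrt (2 / 3)) ∧ dist q y = 1).card))) :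
    10 ≤ (plugSet ν s q).ncard + (Q.filter fun y => dist q y = 1).card ∧
      1 ≤ (plugSet ν s q).ncard +
        (Q.filter fun y => y ∈ fccStacking 1 (Real.sqrt (2 / 3)) ∧ dist q y = 1).card ∧
      7 ≤ (Q.filter fun y => y ∉ fccStacking 1 (Real.sqrt (2 / 3)) ∧ dist q y = 1).card := by
  have h12 := plug_add_deg_le_twelve hQ q
  have h3 := plug_add_onLattice_le_three hQ hqΛ
  have hsplit := card_partners_eq_off_add_on Q q
  omega

open scoped Classical in
/-- **Summary**: every criminal contains an off-lattice ball with at least ten contacts (plugs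
included), at least seven off-lattice partners and at least one lattice contact. -/
theorem exists_offLattice_ten_contacts_of_criminal {ν : EuclideanSpace ℝ (Fin 3)} {s : ℝ}
    {Q : Finset (EuclideanSpace ℝ (Fin 3))} (hQ : IsCriminal ν s Q) :
    ∃ q ∈ Q, q ∉ fccStacking 1 (Real.sqrt (2 / 3)) ∧
      10 ≤ (plugSet ν s q).ncard + (Q.filter fun y => dist q y = 1).card ∧
      1 ≤ (plugSet ν s q).ncard +
        (Q.filter fun y => y ∈ fccStacking 1 (Real.sqrt (2 / 3)) ∧ dist q y = 1).card ∧
      7 ≤ (Q.filter fun y => y ∉ fccStacking 1 (Real.sqrt (2 / 3)) ∧ dist q y = 1).card := by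
  obtain ⟨q, hq, hqΛ, h13⟩ := exists_heavy_offLattice_of_criminal hQ
  exact ⟨q, hq, hqΛ, ten_le_plug_add_deg_of_heavy hQ.1 hqΛ h13⟩

/-! ## At least nine off-lattice balls -/

open scoped Classical in
/-- The ordered contact count of a finite set is at most the number of ordered off-diagonal pairs. -/
theorem orderedContacts_le_card_mul (O : Finset (EuclideanSpace ℝ (Fin 3))) :
    orderedContacts O ≤ O.card * (O.card - 1) := by
  unfold orderedContacts
  calc ((O ×ˢ O).filter fun p => dist p.1 p.2 = 1).card
      ≤ ((O ×ˢ O).filter fun p => p.1 ≠ p.2).card := by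
        refine Finset.card_le_card fun p hp => ?_
        rw [Finset.mem_filter] at hp ⊢
        refine ⟨hp.1, fun h => ?_⟩
        rw [h, dist_self] at hp; norm_num at hp
    _ = O.card * (O.card - 1) := by
        have hoff : ((O ×ˢ O).filter fun p => p.1 ≠ p.2) = O.offDiag := by
          ext p
          simp only [Finset.mem_filter, Finset.mem_product, Finset.mem_offDiag, and_assoc]
        rw [hoff, Finset.offDiag_card, Nat.mul_sub_one]

open scoped Classical in
/-- **A criminal has at least eight off-lattice balls**: `Q_off` has more than `3·#Q_off` contacts,
i.e. `orderedContacts Q_off > 6·#Q_off`, while `orderedContacts ≤ #Q_off (#Q_off − 1)`. -/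
theorem eight_le_card_offLattice_of_criminal {ν : EuclideanSpace ℝ (Fin 3)} {s : ℝ}
    {Q : Finset (EuclideanSpace ℝ (Fin 3))} (hQ : IsCriminal ν s Q) :
    8 ≤ (Q.filter fun y => y ∉ fccStacking 1 (Real.sqrt (2 / 3))).card := by
  set O := Q.filter fun y => y ∉ fccStacking 1 (Real.sqrt (2 / 3)) with hO
  have hD := contactDeficiency_offLattice_lt_of_criminal hQ
  rw [← hO] at hD
  have hdef : contactDeficiency O = 6 * (O.card : ℝ) - (orderedContacts O : ℝ) / 2 := rfl
  rw [hdef] at hD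
  have hle := orderedContacts_le_card_mul O
  have h6 : 6 * O.card < orderedContacts O := by
    have : (6 : ℝ) * O.card < orderedContacts O := by linarith
    exact_mod_cast this
  have h7 : 6 * O.card < O.card * (O.card - 1) := lt_of_lt_of_le h6 hle
  by_contra hlt
  push Not at hlt
  interval_cases h : O.card <;> omega

open scoped Classical in
/-- **A criminal has at least nine off-lattice balls.**  With exactly eight, `Q_off` would have
`orderedContacts > 48` of the `56` ordered pairs, so at most three (unordered) pairs do not touch;
discarding one ball of each leaves five pairwise touching balls, impossible in `ℝ³`. -/
theorem nine_le_card_offLattice_of_criminal {ν : EuclideanSpace ℝ (Fin 3)} {s : ℝ}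
    {Q : Finset (EuclideanSpace ℝ (Fin 3))} (hQ : IsCriminal ν s Q) :
    9 ≤ (Q.filter fun y => y ∉ fccStacking 1 (Real.sqrt (2 / 3))).card := by
  set O := Q.filter fun y => y ∉ fccStacking 1 (Real.sqrt (2 / 3)) with hO
  have h8 : 8 ≤ O.card := eight_le_card_offLattice_of_criminal hQ
  by_contra hlt
  push Not at hlt
  have hcard : O.card = 8 := by omega
  -- `orderedContacts O > 48`
  have hD := contactDeficiency_offLattice_lt_of_criminal hQ
  rw [← hO] at hD
  have hdef : contactDeficiency O = 6 * (O.card : ℝ) - (orderedContacts O : ℝ) / 2 := rfl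
  rw [hdef, hcard] at hD
  have h48 : 48 < orderedContacts O := by
    have : (48 : ℝ) < orderedContacts O := by push_cast at hD; linarith
    exact_mod_cast this
  -- the ordered NON-touching off-diagonal pairs: fewer than `8`
  set B := (O ×ˢ O).filter fun p => p.1 ≠ p.2 ∧ dist p.1 p.2 ≠ 1 with hB
  have hBcard : B.card < 8 := by
    have hsplit : ((O ×ˢ O).filter fun p => p.1 ≠ p.2).card =
        ((O ×ˢ O).filter fun p => dist p.1 p.2 = 1).card + B.card := by
      rw [hB, ← Finset.card_union_of_disjoint]
      · congr 1
        ext p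
        simp only [Finset.mem_filter, Finset.mem_union]
        constructor
        · rintro ⟨hp, hne⟩
          by_cases hd : dist p.1 p.2 = 1
          · exact Or.inl ⟨hp, hd⟩
          · exact Or.inr ⟨hp, hne, hd⟩
        · rintro (⟨hp, hd⟩ | ⟨hp, hne, _⟩)
          · refine ⟨hp, fun h => ?_⟩
            rw [h, dist_self] at hd; norm_num at hd
          · exact ⟨hp, hne⟩
      · rw [Finset.disjoint_left]
        rintro p hp hp'
        exact (Finset.mem_filter.1 hp').2.2 (Finset.mem_filter.1 hp).2
    have hoff : ((O ×ˢ O).filter fun p => p.1 ≠ p.2).card = O.card * (O.card - 1) := by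
      have hoff' : ((O ×ˢ O).filter fun p => p.1 ≠ p.2) = O.offDiag := by
        ext p
        simp only [Finset.mem_filter, Finset.mem_product, Finset.mem_offDiag, and_assoc]
      rw [hoff', Finset.offDiag_card, Nat.mul_sub_one]
    rw [hoff, hcard] at hsplit
    have : ((O ×ˢ O).filter fun p => dist p.1 p.2 = 1).card = orderedContacts O := rfl
    omega
  -- orient the bad pairs by a linear order and delete the smaller endpoints
  set Bl := B.filter fun p => WellOrderingRel p.1 p.2 with hBl
  have hBl2 : 2 * Bl.card ≤ B.card := by
    -- `swap` maps `Bl` injectively into `B \ Bl`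
    have hmap : Bl.image Prod.swap ⊆ B \ Bl := by
      intro p hp
      obtain ⟨p', hp', rfl⟩ := Finset.mem_image.1 hp
      rw [hBl, Finset.mem_filter, hB, Finset.mem_filter, Finset.mem_product] at hp'
      obtain ⟨⟨⟨h1, h2⟩, hne, hd⟩, hw⟩ := hp'
      rw [Finset.mem_sdiff, hBl, Finset.mem_filter, hB, Finset.mem_filter, Finset.mem_product]
      refine ⟨⟨⟨h2, h1⟩, hne.symm, by rw [Prod.fst_swap, Prod.snd_swap, dist_comm]; exact hd⟩, ?_⟩
      rintro ⟨-, hw'⟩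
      rw [Prod.fst_swap, Prod.snd_swap] at hw'
      exact wellOrderingRel_asymm hw hw'
    have hinj : Set.InjOn Prod.swap (Bl : Set (EuclideanSpace ℝ (Fin 3) × EuclideanSpace ℝ (Fin 3))) :=
      fun p _ p' _ h => Prod.swap_injective h
    have hsubB : Bl ⊆ B := by rw [hBl]; exact Finset.filter_subset _ _
    have h1 := Finset.card_le_card hmap
    rw [Finset.card_image_of_injOn hinj, Finset.card_sdiff_of_subset hsubB] at h1
    have h2 := Finset.card_le_card hsubB
    omega
  have hBl3 : Bl.card ≤ 3 := by omega
  set V := Bl.image Prod.fst with hV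
  have hV3 : V.card ≤ 3 := (Finset.card_image_le).trans hBl3
  -- the survivors touch pairwise
  have hgood : ∀ x ∈ O \ V, ∀ y ∈ O \ V, x ≠ y → dist x y = 1 := by
    intro x hx y hy hne
    rw [Finset.mem_sdiff] at hx hy
    by_contra hd
    rcases wellOrderingRel_or hne with hxy | hyx
    · refine hx.2 (Finset.mem_image.2 ⟨(x, y), ?_, rfl⟩)
      rw [hBl, Finset.mem_filter, hB, Finset.mem_filter, Finset.mem_product]
      exact ⟨⟨⟨hx.1, hy.1⟩, hne, hd⟩, hxy⟩
    · refine hy.2 (Finset.mem_image.2 ⟨(y, x), ?_, rfl⟩)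
      rw [hBl, Finset.mem_filter, hB, Finset.mem_filter, Finset.mem_product]
      exact ⟨⟨⟨hy.1, hx.1⟩, hne.symm, by rw [dist_comm]; exact hd⟩, hyx⟩
  have h5 : 5 ≤ (O \ V).card := by
    have := Finset.card_sdiff_add_card_inter O V
    have hint : (O ∩ V).card ≤ 3 := (Finset.card_le_card Finset.inter_subset_right).trans hV3
    omega
  obtain ⟨T, hT, hTcard⟩ := Finset.exists_subset_card_eq h5
  -- five points pairwise at distance `1`: rescale by `2` and contradict
  have e : Fin 5 ≃ T := (T.equivFin.trans (finCongr hTcard)).symm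
  set p : Fin 5 → EuclideanSpace ℝ (Fin 3) := fun i => (2 : ℝ) • ((e i : T) : EuclideanSpace ℝ (Fin 3))
    with hp
  refine Literature.Barriers.AtomisticToContinuum.no_five_pairwise_dist_two p fun i j hij => ?_
  have hne : ((e i : T) : EuclideanSpace ℝ (Fin 3)) ≠ (e j : T) := by
    intro h
    exact hij (e.injective (Subtype.ext h))
  have h1 := hgood _ (hT (e i).2) _ (hT (e j).2) hne
  rw [hp]
  dsimp only
  rw [dist_smul₀, h1]
  norm_num

end Summit.Ventures.Crystal3D.Theorems

end
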